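import Summits.SmoothPoincare4.SmoothPoincare4.Theses.CongruenceShadows

/-!
# Line `pair-rigidity-retraction` — crux `CongruenceShadows.HeegaardHandlebodyCongruenceClosed`
(stmt-SmoothPoincare4-14596, route `route-SmoothPoincare4-CongruenceShadows`, rank 6)

LEAD RESHAPE r1 (prover-line-stmt-SmoothPoincare4-14596-0, 2026-08-16) of the planner's checked skeleton
`Lines/pair-rigidity-retraction.lean` (commit 29f2e227c61d).  Two changes, same composition idea:

1. Every `stub_*` signature is written in IMPORTABLE vocabulary only (`SurfaceGroup`, `s4Kernels.stabilizeIter`,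
   `IsFreeOfRank`, `IsGroupTrisection`, `TrisectionKernels.Iso`, Mathlib), so that each stub can land verbatim as a
   `Theorems/CongruenceShadowsHeegaardHandlebodyCongruenceClosed<Stub>.lean` file (`--supports` the crux) without
   importing this workfile; the local abbreviations (`S`, `N`, `ProductCongruent`, `twisted`, …) are glue only.
2. The printed pair-rigidity lever is CUT DOWN to what the composition really consumes: the twisted pair quotients
   `S ⧸ ⟪N_i ∪ ρN₂⟫` (`i = 0, 1`) must be FREE OF RANK `m+1` — nothing more (`isGroupTrisection_twisted` needs only the
   `free_pairQuotient` fields).  So the old `stub_profinitePairRigidity` (WZ19 + Perelman + Waldhausen + DNB ⇒ a carrier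
   `a ∈ Stab N_i`, `aN₂ = ρN₂`) becomes `stub_profiniteFreenessDetection` (WZ19 + Perelman ⇒ the pair quotient is free),
   and the Waldhausen/Dehn–Nielsen half moves under the EXISTING item `WaldhausenPairs` (stmt-14592):
   `fineApprox_of_shadowApproximation_of_waldhausenPairs : ShadowApproximation → WaldhausenPairs → FineApprox` (proved).
   Net effect: the line's only un-itemed literature debt is profinite DETECTION of `#ᵏ(S¹×S²)` (Wilton–Zalesskii 2019
   Thm A / 2.2 + Perelman), and stub 4 is implied by two existing items.

Notation. `S m = SurfaceGroup (3+3m)`, `N m = s4Kernels.stabilizeIter m = (N₀,N₁,N₂)` (the standard `(3+3m; m+1)`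
group trisection of `S⁴`), `k = m+1`, `A∩B = Stab N₀ ∩ Stab N₁`, `C = Stab N₂` (in `Aut S`), `T_ρ = twisted m ρ =
(N₀, N₁, ρN₂)`, `tripleJoin m ρ = N₀ ⊔ N₁ ⊔ ρN₂` (kernel of `S ↠ G_ρ := π₁` of the reglued 4-manifold),
`pairQuot m i ρ = S ⧸ ⟪N_i ∪ ρN₂⟫` (`= π₁(H_i ∪_ρ H₂)`).  The crux: `ρ` congruent to a product `x∘c` (`x ∈ A∩B`,
`c ∈ C`) modulo EVERY characteristic finite-index `M` (`ProductCongruent`) ⇒ `ρ = x∘c` (`IsProduct`); `crux_iff` is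
the `Iff.rfl` read-back.

## Registered stubs (r1) and composition

* `stub_pairShadowFiniteQuotients` (P1, elementary, provable now): a shadow-standard pair `(N_i, θN₂)` has pair quotient
  with exactly the finite quotients of `F_{m+1}` (cofinality of characteristic levels, PROVED: `exists_characteristic_le`).
* `stub_profiniteFreenessDetection` (P2, in print modulo the kernel↔Heegaard bridge): a twisted pair quotient
  `S ⧸ ⟪N_i ∪ θN₂⟫ = π₁(H_i ∪_θ H₂)` with the finite quotients of `F_{m+1}` IS free of rank `m+1` (DFPR ⇒ `π̂₁ ≅ F̂_{m+1}`;
  Wilton–Zalesskii arXiv:1703.03701 Thm A ⇒ Kneser–Milnor type of `#^{m+1}(S¹×S²)`; Perelman ⇒ no fake summand; so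
  `π₁ ≅ F_{m+1}`).
* `stub_limitsSimplyConnected` (P3, OPEN, genera `≥ 6`): product-congruent `ρ` has `N₀ ⊔ N₁ ⊔ ρN₂ = ⊤`; the genus-3 case is
  the theorem `tripleJoin_zero_eq_top` (cyclic collapse), `limitsSimplyConnected_of_pos` reassembles all genera.
* `stub_fineApprox` (P4, OPEN, = 14595 ∧ 14592 on the fine locus): a product-congruent `ρ` whose `T_ρ` IS a
  `(3+3m; m+1)` group trisection of `{1}` has `Iso N T_ρ`.  PROVED: `fineApprox_of_shadowApproximation_of_waldhausenPairs`.
* `gate_of_parts` (sorry-free), `HeegaardHandlebodyCongruenceClosed_of` (the ONLY theorem concluding the crux by name; no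
  hypotheses; sorries only via the four stubs), necessity `limitsSimplyConnected_of_crux`, `fineApprox_of_crux`,
  `crux_iff_parts : (P1 → P2 →) crux ↔ P3 ∧ P4`, `gate_of_items : P1 → P2 → P3 → ShadowApproximation → WaldhausenPairs → gate`.

## Disproof.lean (cdisprove cycle 1, commit 843ff1fb0995) — honoured as in the planner's card

No `_false_without_` theorem, no landed `Negative/` lemma (2026-08-16T02:10Z).  All stubs quantify over ALL characteristic
finite-index levels (`not_singleLevelSuffices`, `cruxWithoutFiniteIndex_holds`), none asserts universality
(`not_conclusionUniversal`: `ρ₀` violates P1's hypothesis at the abelian level), and the anatomy lemma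
`tripleJoin_sup_eq_top_of_inGateMod` is re-proved here (`tripleJoin_sup_eq_top`) — it is why P3 is the honest residual.
-/

noncomputable section

namespace Summit.SmoothPoincare4.SmoothPoincare4.Cruxes.HeegaardHandlebodyCongruenceClosed.PairRigidityRetraction

set_option linter.dupNamespace false

open Literature.Topology.FourManifolds Subgroup
open Summit.SmoothPoincare4.SmoothPoincare4.Theses.CongruenceShadows
  (HeegaardHandlebodyCongruenceClosed ShadowApproximation WaldhausenPairs)

/-! ## Vocabulary (local glue over `GroupTrisections.lean`; no new Literature notions) -/

/-- `S m = S_{3+3m} = π₁(Σ_{3+3m})`. -/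
abbrev S (m : ℕ) : Type := SurfaceGroup (3 + 3 * m)

/-- `N m = (N₀, N₁, N₂)`, the `m`-fold stabilised standard `S⁴` kernel triple (genus `3+3m`). -/
abbrev N (m : ℕ) : TrisectionKernels (3 + 3 * m) := s4Kernels.stabilizeIter m

/-- `x` stabilises `N m i` (membership of `Stab(N_i) ≤ Aut S`). -/
def Stab (m : ℕ) (i : Fin 3) (x : S m ≃* S m) : Prop := (N m i).map x.toMonoidHom = N m i

/-- The crux HYPOTHESIS for one `ρ`: congruent to a product `x ∘ c` (`x ∈ A∩B`, `c ∈ C`) modulo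
every characteristic finite-index `M` ("`ρ` lies in the fine congruence closure of `(A∩B)·C`"). -/
def ProductCongruent (m : ℕ) (ρ : S m ≃* S m) : Prop :=
  ∀ M : Subgroup (S m), M.Characteristic → M.FiniteIndex →
    ∃ x c : S m ≃* S m, Stab m 0 x ∧ Stab m 1 x ∧ Stab m 2 c ∧ ∀ s, ρ s * (x (c s))⁻¹ ∈ M

/-- The crux CONCLUSION for one `ρ`: `ρ ∈ (A∩B)·C`. -/
def IsProduct (m : ℕ) (ρ : S m ≃* S m) : Prop :=
  ∃ x c : S m ≃* S m, Stab m 0 x ∧ Stab m 1 x ∧ Stab m 2 c ∧ ∀ s, ρ s = x (c s)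

/-- Read-back: the crux is literally `∀ m ρ, ProductCongruent m ρ → IsProduct m ρ`. -/
theorem crux_iff :
    HeegaardHandlebodyCongruenceClosed ↔ ∀ (m : ℕ) (ρ : S m ≃* S m), ProductCongruent m ρ → IsProduct m ρ :=
  Iff.rfl

/-- The `ρ`-twisted triple `T_ρ = (N₀, N₁, ρN₂)`. -/
def twisted (m : ℕ) (ρ : S m ≃* S m) : TrisectionKernels (3 + 3 * m) :=
  ![N m 0, N m 1, (N m 2).map ρ.toMonoidHom]

@[simp] theorem twisted_zero (m : ℕ) (ρ : S m ≃* S m) : twisted m ρ 0 = N m 0 := rfl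
@[simp] theorem twisted_one (m : ℕ) (ρ : S m ≃* S m) : twisted m ρ 1 = N m 1 := rfl
@[simp] theorem twisted_two (m : ℕ) (ρ : S m ≃* S m) :
    twisted m ρ 2 = (N m 2).map ρ.toMonoidHom := rfl

/-- `N₀ ⊔ N₁ ⊔ ρN₂`, the kernel of `S ↠ G_ρ` (triple quotient of `T_ρ`; all three are normal). -/
abbrev tripleJoin (m : ℕ) (ρ : S m ≃* S m) : Subgroup (S m) :=
  N m 0 ⊔ N m 1 ⊔ (N m 2).map ρ.toMonoidHom

/-- The twisted pair quotient `S ⧸ ⟪N_i ∪ θN₂⟫ = π₁(H_i ∪_θ H₂)` (for `i ≠ 2` it is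
`(twisted m θ).pairQuotient i 2`, definitionally at `i = 0, 1`). -/
abbrev pairQuot (m : ℕ) (i : Fin 3) (θ : S m ≃* S m) : Type :=
  S m ⧸ normalClosure ((N m i : Set (S m)) ∪ ((N m 2).map θ.toMonoidHom : Subgroup (S m)))

/-- SHADOW-standardness of the PAIR `(N_i, θN₂)`: at every characteristic finite level ONE automorphism
carries `(N_i M, N₂ M)` to `(N_i M, θN₂ M)`. -/
def PairShadowStandard (m : ℕ) (i : Fin 3) (θ : S m ≃* S m) : Prop :=
  ∀ M : Subgroup (S m), M.Characteristic → M.FiniteIndex →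
    ∃ a : S m ≃* S m, (N m i ⊔ M).map a.toMonoidHom = N m i ⊔ M ∧
      (N m 2 ⊔ M).map a.toMonoidHom = (N m 2).map θ.toMonoidHom ⊔ M

/-- `pairQuot m i θ` has the SAME FINITE QUOTIENTS as `F_{m+1}` (elementary form, no topology). -/
def PairQuotSameFiniteQuotients (m : ℕ) (i : Fin 3) (θ : S m ≃* S m) : Prop :=
  ∀ (Q : Type) [Group Q] [Finite Q],
    (∃ f : pairQuot m i θ →* Q, Function.Surjective f) ↔ (∃ f : FreeGroup (Fin (m + 1)) →* Q, Function.Surjective f)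

/-! ## Statements of the stubs (local names; the registered `stub_*` theorems below restate them unfolded) -/

/-- P1: a shadow-standard pair has pair quotient with the finite quotients of `F_{m+1}`. -/
def PairShadowFiniteQuotients : Prop :=
  ∀ (m : ℕ) (i : Fin 3), i ≠ 2 → ∀ θ : S m ≃* S m, PairShadowStandard m i θ → PairQuotSameFiniteQuotients m i θ

/-- P2: PROFINITE DETECTION OF FREENESS for twisted pair quotients (= closed 3-manifold groups
`π₁(H_i ∪_θ H₂)`): same finite quotients as `F_{m+1}` ⇒ free of rank `m+1`. -/
def ProfiniteFreenessDetection : Prop :=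
  ∀ (m : ℕ) (i : Fin 3), i ≠ 2 → ∀ θ : S m ≃* S m, PairQuotSameFiniteQuotients m i θ → IsFreeOfRank (pairQuot m i θ) (m + 1)

/-- P3 (all genera): a congruence limit of products glues a simply connected 4-manifold. -/
def LimitsSimplyConnected : Prop :=
  ∀ (m : ℕ) (ρ : S m ≃* S m), ProductCongruent m ρ → tripleJoin m ρ = ⊤

/-- P3 as registered (genera `≥ 6`). -/
def LimitsSimplyConnectedPos : Prop :=
  ∀ (m : ℕ) (ρ : S (m + 1) ≃* S (m + 1)), ProductCongruent (m + 1) ρ → tripleJoin (m + 1) ρ = ⊤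

/-- P4: fine approximation (`ShadowApproximation ∧ WaldhausenPairs` on the fine locus). -/
def FineApprox : Prop :=
  ∀ (m : ℕ) (ρ : S m ≃* S m), ProductCongruent m ρ →
    IsGroupTrisection (3 + 3 * m) (m + 1) (PUnit : Type) (twisted m ρ) →
    TrisectionKernels.Iso (N m) (twisted m ρ)

/-! ## Registered stubs (signatures in importable vocabulary only) -/

/-- STUB P1 (size M, provable now).  For `i ∈ {0,1}` and `θ ∈ Aut S_{3+3m}`: if at every characteristic
finite-index `M` one automorphism carries `(N_i ⊔ M, N₂ ⊔ M)` onto `(N_i ⊔ M, θN₂ ⊔ M)`, then for every finite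
group `Q`, `S ⧸ ⟪N_i ∪ θN₂⟫` surjects onto `Q` iff `F_{m+1}` does. -/
theorem stub_pairShadowFiniteQuotients :
    ∀ (m : ℕ) (i : Fin 3), i ≠ 2 → ∀ θ : SurfaceGroup (3 + 3 * m) ≃* SurfaceGroup (3 + 3 * m),
      (∀ M : Subgroup (SurfaceGroup (3 + 3 * m)), M.Characteristic → M.FiniteIndex →
        ∃ a : SurfaceGroup (3 + 3 * m) ≃* SurfaceGroup (3 + 3 * m),
          (s4Kernels.stabilizeIter m i ⊔ M).map a.toMonoidHom = s4Kernels.stabilizeIter m i ⊔ M ∧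
          (s4Kernels.stabilizeIter m 2 ⊔ M).map a.toMonoidHom =
            (s4Kernels.stabilizeIter m 2).map θ.toMonoidHom ⊔ M) →
      ∀ (Q : Type) [Group Q] [Finite Q],
        (∃ f : SurfaceGroup (3 + 3 * m) ⧸ normalClosure ((s4Kernels.stabilizeIter m i : Set (SurfaceGroup (3 + 3 * m))) ∪
            ((s4Kernels.stabilizeIter m 2).map θ.toMonoidHom : Subgroup (SurfaceGroup (3 + 3 * m)))) →* Q,
          Function.Surjective f) ↔
        (∃ f : FreeGroup (Fin (m + 1)) →* Q, Function.Surjective f) := by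
  sorry

/-- STUB P2 (in print modulo the kernel↔Heegaard-splitting bridge; size XL to vendor: van Kampen for
`H_i ∪_θ H₂`, DFPR, Wilton–Zalesskii 2019 Thm A, Perelman).  For `i ∈ {0,1}` and `θ ∈ Aut S_{3+3m}`: if
`S ⧸ ⟪N_i ∪ θN₂⟫` surjects onto exactly the finite groups `F_{m+1}` surjects onto, then it is free of rank `m+1`. -/
theorem stub_profiniteFreenessDetection :
    ∀ (m : ℕ) (i : Fin 3), i ≠ 2 → ∀ θ : SurfaceGroup (3 + 3 * m) ≃* SurfaceGroup (3 + 3 * m),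
      (∀ (Q : Type) [Group Q] [Finite Q],
        (∃ f : SurfaceGroup (3 + 3 * m) ⧸ normalClosure ((s4Kernels.stabilizeIter m i : Set (SurfaceGroup (3 + 3 * m))) ∪
            ((s4Kernels.stabilizeIter m 2).map θ.toMonoidHom : Subgroup (SurfaceGroup (3 + 3 * m)))) →* Q,
          Function.Surjective f) ↔
        (∃ f : FreeGroup (Fin (m + 1)) →* Q, Function.Surjective f)) →
      IsFreeOfRank (SurfaceGroup (3 + 3 * m) ⧸ normalClosure
        ((s4Kernels.stabilizeIter m i : Set (SurfaceGroup (3 + 3 * m))) ∪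
          ((s4Kernels.stabilizeIter m 2).map θ.toMonoidHom : Subgroup (SurfaceGroup (3 + 3 * m))))) (m + 1) := by
  sorry

/-- STUB P3 (OPEN, genus `≥ 6`; TRUE iff no trisected Kervaire–Higman-type homology sphere enters the fine
closure; the genus-3 case is the theorem `tripleJoin_zero_eq_top`).  For every `m` and every `ρ ∈ Aut S_{3+3(m+1)}`
that is product-congruent at every characteristic finite-index level: `N₀ ⊔ N₁ ⊔ ρN₂ = ⊤`. -/
theorem stub_limitsSimplyConnected :
    ∀ (m : ℕ) (ρ : SurfaceGroup (3 + 3 * (m + 1)) ≃* SurfaceGroup (3 + 3 * (m + 1))),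
      (∀ M : Subgroup (SurfaceGroup (3 + 3 * (m + 1))), M.Characteristic → M.FiniteIndex →
        ∃ x c : SurfaceGroup (3 + 3 * (m + 1)) ≃* SurfaceGroup (3 + 3 * (m + 1)),
          (s4Kernels.stabilizeIter (m + 1) 0).map x.toMonoidHom = s4Kernels.stabilizeIter (m + 1) 0 ∧
          (s4Kernels.stabilizeIter (m + 1) 1).map x.toMonoidHom = s4Kernels.stabilizeIter (m + 1) 1 ∧
          (s4Kernels.stabilizeIter (m + 1) 2).map c.toMonoidHom = s4Kernels.stabilizeIter (m + 1) 2 ∧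
          ∀ s, ρ s * (x (c s))⁻¹ ∈ M) →
      s4Kernels.stabilizeIter (m + 1) 0 ⊔ s4Kernels.stabilizeIter (m + 1) 1 ⊔
        (s4Kernels.stabilizeIter (m + 1) 2).map ρ.toMonoidHom = ⊤ := by
  sorry

/-- STUB P4 (OPEN, research: `ShadowApproximation` (14595) ∧ `WaldhausenPairs` (14592) restricted to the fine locus,
see `fineApprox_of_shadowApproximation_of_waldhausenPairs`).  For every `m` and every product-congruent
`ρ ∈ Aut S_{3+3m}` whose twisted triple `(N₀, N₁, ρN₂)` is a `(3+3m; m+1)` group trisection of `{1}`: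
`Iso N (N₀, N₁, ρN₂)`. -/
theorem stub_fineApprox :
    ∀ (m : ℕ) (ρ : SurfaceGroup (3 + 3 * m) ≃* SurfaceGroup (3 + 3 * m)),
      (∀ M : Subgroup (SurfaceGroup (3 + 3 * m)), M.Characteristic → M.FiniteIndex →
        ∃ x c : SurfaceGroup (3 + 3 * m) ≃* SurfaceGroup (3 + 3 * m),
          (s4Kernels.stabilizeIter m 0).map x.toMonoidHom = s4Kernels.stabilizeIter m 0 ∧
          (s4Kernels.stabilizeIter m 1).map x.toMonoidHom = s4Kernels.stabilizeIter m 1 ∧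
          (s4Kernels.stabilizeIter m 2).map c.toMonoidHom = s4Kernels.stabilizeIter m 2 ∧
          ∀ s, ρ s * (x (c s))⁻¹ ∈ M) →
      IsGroupTrisection (3 + 3 * m) (m + 1) (PUnit : Type)
        ![s4Kernels.stabilizeIter m 0, s4Kernels.stabilizeIter m 1, (s4Kernels.stabilizeIter m 2).map ρ.toMonoidHom] →
      TrisectionKernels.Iso (s4Kernels.stabilizeIter m)
        ![s4Kernels.stabilizeIter m 0, s4Kernels.stabilizeIter m 1, (s4Kernels.stabilizeIter m 2).map ρ.toMonoidHom] := by
  sorry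

/-! ### The registered stubs ARE the local statements (definitional read-backs) -/

theorem p1_of_stub : PairShadowFiniteQuotients := stub_pairShadowFiniteQuotients
theorem p2_of_stub : ProfiniteFreenessDetection := stub_profiniteFreenessDetection
theorem p3_of_stub : LimitsSimplyConnectedPos := stub_limitsSimplyConnected
theorem p4_of_stub : FineApprox := stub_fineApprox

/-! ## Elementary lemmas -/

theorem toMonoidHom_trans {m : ℕ} (e₁ e₂ : S m ≃* S m) :
    (e₁.trans e₂).toMonoidHom = e₂.toMonoidHom.comp e₁.toMonoidHom :=
  MonoidHom.ext fun _ => rfl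

theorem map_trans {m : ℕ} (e₁ e₂ : S m ≃* S m) (K : Subgroup (S m)) :
    K.map (e₁.trans e₂).toMonoidHom = (K.map e₁.toMonoidHom).map e₂.toMonoidHom := by
  rw [toMonoidHom_trans, Subgroup.map_map]

theorem map_self_trans_symm {m : ℕ} (e : S m ≃* S m) (K : Subgroup (S m)) :
    (K.map e.toMonoidHom).map e.symm.toMonoidHom = K := by
  rw [← map_trans]
  have : (e.trans e.symm).toMonoidHom = MonoidHom.id _ := MonoidHom.ext fun s => by simp
  rw [this, Subgroup.map_id]

/-- A characteristic subgroup is carried to itself by every automorphism. -/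
theorem map_char {m : ℕ} (x : S m ≃* S m) {M : Subgroup (S m)} (hM : M.Characteristic) :
    M.map x.toMonoidHom = M :=
  (Subgroup.characteristic_iff_map_eq.mp hM) x

/-- Pointwise congruence `ρ ≡ x∘c (mod M)` moves images of subgroups only within `M`
(Disproof.lean `map_sup_eq_of_congr`, re-proved). -/
theorem map_sup_eq_of_congr {m : ℕ} {ρ x c : S m ≃* S m} {M : Subgroup (S m)}
    (h : ∀ s, ρ s * (x (c s))⁻¹ ∈ M) (H : Subgroup (S m)) :
    H.map ρ.toMonoidHom ⊔ M = (H.map c.toMonoidHom).map x.toMonoidHom ⊔ M := by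
  apply le_antisymm
  · refine sup_le ?_ le_sup_right
    rintro _ ⟨s, hs, rfl⟩
    have : ρ s = (ρ s * (x (c s))⁻¹) * x (c s) := by group
    rw [MulEquiv.coe_toMonoidHom, this]
    exact mul_mem (mem_sup_right (h s)) (mem_sup_left ⟨c s, ⟨s, hs, rfl⟩, rfl⟩)
  · refine sup_le ?_ le_sup_right
    rintro _ ⟨_, ⟨s, hs, rfl⟩, rfl⟩
    have : x (c s) = (ρ s * (x (c s))⁻¹)⁻¹ * ρ s := by group
    rw [MulEquiv.coe_toMonoidHom, MulEquiv.coe_toMonoidHom, this]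
    exact mul_mem (mem_sup_right (inv_mem (h s))) (mem_sup_left ⟨s, hs, rfl⟩)

/-- The standard triple is a `(3+3m; m+1)` group trisection of the trivial group (the two
discharged named facts of `GroupTrisections.lean`, iterated). -/
theorem N_isGroupTrisection (m : ℕ) :
    IsGroupTrisection (3 + 3 * m) (m + 1) (PUnit : Type) (N m) := by
  induction m with
  | zero => exact s4Kernels_isGroupTrisection_holds
  | succ m ih => exact stabilize_isGroupTrisection_holds _ _ _ _ ih

instance N_normal (m : ℕ) (i : Fin 3) : (N m i).Normal := (N_isGroupTrisection m).normal i

instance map_N_normal (m : ℕ) (i : Fin 3) (ρ : S m ≃* S m) :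
    ((N m i).map ρ.toMonoidHom).Normal :=
  Subgroup.Normal.map inferInstance _ ρ.surjective

/-- The standard kernels normally generate `S` (triple quotient of `N m` is trivial). -/
theorem normalClosure_N_eq_top (m : ℕ) :
    normalClosure (⋃ i, (N m i : Set (S m))) = ⊤ := by
  obtain ⟨e⟩ := (N_isGroupTrisection m).triple
  haveI : Subsingleton (TrisectionKernels.tripleQuotient (N m)) := e.toEquiv.subsingleton
  exact QuotientGroup.subgroup_eq_top_of_subsingleton _ inferInstance

/-- `N₀ ⊔ N₁ ⊔ N₂ = ⊤`. -/
theorem sup_N_eq_top (m : ℕ) : N m 0 ⊔ N m 1 ⊔ N m 2 = ⊤ := by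
  rw [eq_top_iff, ← normalClosure_N_eq_top m]
  refine normalClosure_le_normal (Set.iUnion_subset fun i => ?_)
  fin_cases i
  · exact fun s hs => mem_sup_left (mem_sup_left hs)
  · exact fun s hs => mem_sup_left (mem_sup_right hs)
  · exact fun s hs => mem_sup_right hs

/-- Non-vacuity: products satisfy the hypothesis (at every `M`). -/
theorem productCongruent_of_isProduct {m : ℕ} {ρ : S m ≃* S m} (h : IsProduct m ρ) :
    ProductCongruent m ρ := by
  obtain ⟨x, c, h0, h1, h2, hs⟩ := h
  exact fun M _ _ => ⟨x, c, h0, h1, h2, fun s => by simp [hs s]⟩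

/-! ## The crux conclusion is `Iso N T_ρ` -/

/-- `IsProduct ρ → Iso N T_ρ` (the carrier is `x`). -/
theorem iso_of_isProduct {m : ℕ} {ρ : S m ≃* S m} (h : IsProduct m ρ) :
    TrisectionKernels.Iso (N m) (twisted m ρ) := by
  obtain ⟨x, c, hx0, hx1, hc, hs⟩ := h
  refine ⟨x, fun i => ?_⟩
  fin_cases i
  · exact hx0
  · exact hx1
  · show (N m 2).map x.toMonoidHom = twisted m ρ 2
    rw [twisted_two]
    have hρ : ρ = c.trans x := MulEquiv.ext fun s => hs s
    rw [hρ, map_trans, hc]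

/-- `Iso N T_ρ → IsProduct ρ` (`x := α`, `c := α⁻¹ ∘ ρ`). -/
theorem isProduct_of_iso {m : ℕ} {ρ : S m ≃* S m} (h : TrisectionKernels.Iso (N m) (twisted m ρ)) :
    IsProduct m ρ := by
  obtain ⟨α, hα⟩ := h
  have h0 : (N m 0).map α.toMonoidHom = N m 0 := by simpa using hα 0
  have h1 : (N m 1).map α.toMonoidHom = N m 1 := by simpa using hα 1
  have h2 : (N m 2).map α.toMonoidHom = (N m 2).map ρ.toMonoidHom := by simpa using hα 2
  refine ⟨α, ρ.trans α.symm, h0, h1, ?_, fun s => by simp⟩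
  show (N m 2).map (ρ.trans α.symm).toMonoidHom = N m 2
  rw [map_trans, ← h2, map_self_trans_symm]

/-! ## From the fine-closure hypothesis: shadows, level collapse -/

/-- Product-congruence hands over SHADOW-standardness of the two pairs `(N_i, ρN₂)`, `i = 0, 1`
(witness `a_M := x_M`). -/
theorem pairShadow_of_productCongruent {m : ℕ} {ρ : S m ≃* S m} (h : ProductCongruent m ρ)
    (i : Fin 3) (hi : i ≠ 2) : PairShadowStandard m i ρ := by
  intro M hM hF
  obtain ⟨x, c, hx0, hx1, hc, hs⟩ := h M hM hF
  have hNi : (N m i).map x.toMonoidHom = N m i := by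
    fin_cases i
    · exact hx0
    · exact hx1
    · exact absurd rfl hi
  refine ⟨x, ?_, ?_⟩
  · rw [Subgroup.map_sup, map_char x hM, hNi]
  · rw [Subgroup.map_sup, map_char x hM, map_sup_eq_of_congr hs (N m 2),
      show (N m 2).map c.toMonoidHom = N m 2 from hc]

/-- Product-congruence hands over standardness of ALL THREE shadows of `T_ρ` simultaneously
(witness `ψ_M := x_M`) — the shadow hypothesis of `ShadowApproximation` for `K = T_ρ`. -/
theorem tripleShadow_of_productCongruent {m : ℕ} {ρ : S m ≃* S m} (h : ProductCongruent m ρ) :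
    ∀ M : Subgroup (S m), M.Characteristic → M.FiniteIndex →
      ∃ ψ : S m ≃* S m, ∀ i : Fin 3, (N m i ⊔ M).map ψ.toMonoidHom = twisted m ρ i ⊔ M := by
  intro M hM hF
  obtain ⟨x, c, hx0, hx1, hc, hs⟩ := h M hM hF
  refine ⟨x, fun i => ?_⟩
  fin_cases i
  · show (N m 0 ⊔ M).map x.toMonoidHom = N m 0 ⊔ M
    rw [Subgroup.map_sup, map_char x hM, show (N m 0).map x.toMonoidHom = N m 0 from hx0]
  · show (N m 1 ⊔ M).map x.toMonoidHom = N m 1 ⊔ M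
    rw [Subgroup.map_sup, map_char x hM, show (N m 1).map x.toMonoidHom = N m 1 from hx1]
  · show (N m 2 ⊔ M).map x.toMonoidHom = (N m 2).map ρ.toMonoidHom ⊔ M
    rw [Subgroup.map_sup, map_char x hM, map_sup_eq_of_congr hs (N m 2),
      show (N m 2).map c.toMonoidHom = N m 2 from hc]

/-- LEVEL COLLAPSE (Disproof.lean `tripleJoin_sup_eq_top_of_inGateMod`, re-proved): under the hypothesis,
`G_ρ` dies modulo every characteristic finite level — `G_ρ` is profinitely trivial. -/
theorem tripleJoin_sup_eq_top {m : ℕ} {ρ : S m ≃* S m} (h : ProductCongruent m ρ)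
    (M : Subgroup (S m)) (hM : M.Characteristic) (hF : M.FiniteIndex) : tripleJoin m ρ ⊔ M = ⊤ := by
  obtain ⟨x, c, h0, h1, h2, hs⟩ := h M hM hF
  haveI := hM
  haveI : M.Normal := inferInstance
  have hx : Function.Surjective x.toMonoidHom := x.surjective
  have e2 : (N m 2).map ρ.toMonoidHom ⊔ M = (N m 2).map x.toMonoidHom ⊔ M := by
    rw [map_sup_eq_of_congr hs, show (N m 2).map c.toMonoidHom = N m 2 from h2]
  have key : (⊤ : Subgroup (S m)).map x.toMonoidHom ≤ tripleJoin m ρ ⊔ M := by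
    rw [← normalClosure_N_eq_top m, map_normalClosure _ _ hx]
    refine normalClosure_le_normal ?_
    rintro _ ⟨s, hs', rfl⟩
    simp only [Set.mem_iUnion, SetLike.mem_coe] at hs'
    obtain ⟨i, hi⟩ := hs'
    fin_cases i
    · exact mem_sup_left (mem_sup_left (mem_sup_left ((show (N m 0).map x.toMonoidHom = N m 0 from h0).le ⟨s, hi, rfl⟩)))
    · exact mem_sup_left (mem_sup_left (mem_sup_right ((show (N m 1).map x.toMonoidHom = N m 1 from h1).le ⟨s, hi, rfl⟩)))
    · have : x.toMonoidHom s ∈ (N m 2).map ρ.toMonoidHom ⊔ M := by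
        rw [e2]; exact mem_sup_left ⟨s, hi, rfl⟩
      exact (sup_le_sup_right le_sup_right M) this
  rw [eq_top_iff]
  refine le_trans ?_ key
  rw [← MonoidHom.range_eq_map, MonoidHom.range_eq_top.2 hx]

/-! ## The twisted triple is a group trisection of `{1}` once its two twisted pair quotients are free
and its triple quotient is trivial -/

/-- Freeness of a pair quotient is symmetric in the slots. -/
theorem isFreeOfRank_pairQuotient_symm {g k : ℕ} (K : TrisectionKernels g) (i j : Fin 3)
    (h : IsFreeOfRank (K.pairQuotient i j) k) : IsFreeOfRank (K.pairQuotient j i) k :=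
  h.of_mulEquiv (QuotientGroup.quotientMulEquivOfEq (by rw [Set.union_comm]))

/-- The twisted `(0,2)` pair quotient IS `pairQuot m 0 ρ` and the `(1,2)` one IS `pairQuot m 1 ρ`. -/
theorem pairQuotient_twisted_zero (m : ℕ) (ρ : S m ≃* S m) :
    (twisted m ρ).pairQuotient 0 2 = pairQuot m 0 ρ := rfl
theorem pairQuotient_twisted_one (m : ℕ) (ρ : S m ≃* S m) :
    (twisted m ρ).pairQuotient 1 2 = pairQuot m 1 ρ := rfl

/-- A trivial triple join gives a trivial triple quotient. -/
theorem normalClosure_twisted_eq_top {m : ℕ} {ρ : S m ≃* S m} (htop : tripleJoin m ρ = ⊤) :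
    normalClosure (⋃ i, (twisted m ρ i : Set (S m))) = ⊤ := by
  rw [eq_top_iff, ← htop]
  refine sup_le (sup_le ?_ ?_) ?_
  · exact fun s hs => subset_normalClosure (Set.mem_iUnion.2 ⟨0, hs⟩)
  · exact fun s hs => subset_normalClosure (Set.mem_iUnion.2 ⟨1, hs⟩)
  · exact fun s hs => subset_normalClosure (Set.mem_iUnion.2 ⟨2, hs⟩)

/-- **`T_ρ` is a `(3+3m; m+1)` group trisection of `{1}`** as soon as the two twisted pair quotients
`S ⧸ ⟪N₀ ∪ ρN₂⟫`, `S ⧸ ⟪N₁ ∪ ρN₂⟫` are free of rank `m+1` and `G_ρ = 1`. -/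
theorem isGroupTrisection_twisted {m : ℕ} {ρ : S m ≃* S m}
    (h0 : IsFreeOfRank (pairQuot m 0 ρ) (m + 1)) (h1 : IsFreeOfRank (pairQuot m 1 ρ) (m + 1))
    (htop : tripleJoin m ρ = ⊤) :
    IsGroupTrisection (3 + 3 * m) (m + 1) (PUnit : Type) (twisted m ρ) := by
  have hN := N_isGroupTrisection m
  have h02 : IsFreeOfRank ((twisted m ρ).pairQuotient 0 2) (m + 1) := h0
  have h12 : IsFreeOfRank ((twisted m ρ).pairQuotient 1 2) (m + 1) := h1
  refine ⟨?_, ?_, ?_, ?_⟩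
  · intro i
    fin_cases i
    · exact hN.normal 0
    · exact hN.normal 1
    · exact map_N_normal m 2 ρ
  · intro i
    fin_cases i
    · exact hN.free_quotient 0
    · exact hN.free_quotient 1
    · have h2 := hN.free_quotient 2
      change IsFreeOfRank (S m ⧸ normalClosure
        (((N m 2).map ρ.toMonoidHom : Subgroup (S m)) : Set (S m))) (3 + 3 * m)
      have e₁ : S m ⧸ normalClosure ((N m 2 : Subgroup (S m)) : Set (S m)) ≃* S m ⧸ N m 2 :=
        QuotientGroup.quotientMulEquivOfEq (normalClosure_eq_self _)
      have e₂ : S m ⧸ N m 2 ≃* S m ⧸ (N m 2).map ρ.toMonoidHom :=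
        QuotientGroup.congr (N m 2) ((N m 2).map ρ.toMonoidHom) ρ rfl
      have e₃ : S m ⧸ (N m 2).map ρ.toMonoidHom ≃*
          S m ⧸ normalClosure (((N m 2).map ρ.toMonoidHom : Subgroup (S m)) : Set (S m)) :=
        QuotientGroup.quotientMulEquivOfEq (normalClosure_eq_self _).symm
      exact ((h2.of_mulEquiv e₁).of_mulEquiv e₂).of_mulEquiv e₃
  · intro i j hij
    fin_cases i <;> fin_cases j
    · exact absurd rfl hij
    · exact hN.free_pairQuotient 0 1 (by decide)
    · exact h02
    · exact hN.free_pairQuotient 1 0 (by decide)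
    · exact absurd rfl hij
    · exact h12
    · exact isFreeOfRank_pairQuotient_symm _ _ _ h02
    · exact isFreeOfRank_pairQuotient_symm _ _ _ h12
    · exact absurd rfl hij
  · haveI : Subsingleton ((twisted m ρ).tripleQuotient) := by
      change Subsingleton (S m ⧸ normalClosure (⋃ i, (twisted m ρ i : Set (S m))))
      rw [normalClosure_twisted_eq_top htop]
      exact QuotientGroup.subsingleton_quotient_top
    letI : Unique ((twisted m ρ).tripleQuotient) := uniqueOfSubsingleton 1
    exact ⟨MulEquiv.ofUnique⟩

/-! ## Dividends (sorry-free) for the stub provers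

(1) COFINALITY — characteristic finite-index subgroups are cofinal in the finitely generated group `S` (the
characteristic core `⨅_{f : S →* Q} ker f` at the finite group `Q = S ⧸ core H`); this is the one non-bookkeeping
ingredient of P1 and of the `m = 0` case of P3. (2) PROFINITE TRIVIALITY of `G_ρ` in Hom-form: every hom from `S`
to a finite group killing `N₀, N₁, ρN₂` is trivial — so P3 asks exactly for "`Ĝ_ρ = 1 ⇒ G_ρ = 1` on the fine
locus", automatic when `G_ρ` is cyclic (`m = 0`). -/

section Cofinal

variable {m : ℕ}

/-- Homomorphisms from `S` to a finite group form a finite set (determined on the generators). -/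
instance finite_hom {Q : Type} [Group Q] [Finite Q] : Finite (S m →* Q) :=
  Finite.of_injective
    (fun f : S m →* Q => fun p : surfaceGen (3 + 3 * m) => f (PresentedGroup.of p))
    (fun _ _ h => PresentedGroup.ext fun p => congrFun h p)

/-- The characteristic core of `S` at a (finite) group `Q`: `⨅_{f : S →* Q} ker f`. -/
def charCore (m : ℕ) (Q : Type) [Group Q] : Subgroup (S m) := ⨅ f : S m →* Q, f.ker

theorem charCore_le_ker {Q : Type} [Group Q] (f : S m →* Q) : charCore m Q ≤ f.ker :=
  iInf_le _ f

theorem charCore_characteristic (Q : Type) [Group Q] : (charCore m Q).Characteristic := by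
  refine Subgroup.characteristic_iff_le_comap.2 fun φ s hs => ?_
  rw [Subgroup.mem_comap]
  simp only [charCore, Subgroup.mem_iInf, MonoidHom.mem_ker] at hs ⊢
  intro f
  exact hs (f.comp φ.toMonoidHom)

instance charCore_finiteIndex (Q : Type) [Group Q] [Finite Q] : (charCore m Q).FiniteIndex :=
  Subgroup.finiteIndex_iInf fun _ => inferInstance

/-- **Cofinality.** Every finite-index subgroup of `S = S_{3+3m}` contains a characteristic
finite-index subgroup. -/
theorem exists_characteristic_le (H : Subgroup (S m)) [H.FiniteIndex] :
    ∃ M : Subgroup (S m), M.Characteristic ∧ M.FiniteIndex ∧ M ≤ H := by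
  refine ⟨charCore m (S m ⧸ H.normalCore), charCore_characteristic _, charCore_finiteIndex _, ?_⟩
  calc charCore m (S m ⧸ H.normalCore) ≤ (QuotientGroup.mk' H.normalCore).ker := charCore_le_ker _
    _ = H.normalCore := QuotientGroup.ker_mk' _
    _ ≤ H := Subgroup.normalCore_le H

/-- **`Ĝ_ρ = 1` on the fine locus** (Hom-form): every homomorphism from `S` to a finite group that
kills `N₀ ⊔ N₁ ⊔ ρN₂` is trivial. -/
theorem hom_trivial_of_productCongruent {ρ : S m ≃* S m} (h : ProductCongruent m ρ)
    {Q : Type} [Group Q] [Finite Q] (f : S m →* Q) (hf : tripleJoin m ρ ≤ f.ker) (s : S m) :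
    f s = 1 := by
  obtain ⟨M, hM, hF, hle⟩ := exists_characteristic_le f.ker
  have htop := tripleJoin_sup_eq_top h M hM hF
  have hs : s ∈ tripleJoin m ρ ⊔ M := by rw [htop]; exact Subgroup.mem_top s
  exact (sup_le hf hle) hs

/-- Equivalent form of P3 for ONE `ρ`: it suffices that a non-trivial `G_ρ` have SOME non-trivial finite
quotient (true for cyclic `G_ρ`, hence at `m = 0`; false in general exactly for Higman-type `G_ρ`). -/
theorem tripleJoin_eq_top_of_finiteQuotient {ρ : S m ≃* S m} (h : ProductCongruent m ρ)
    (hq : tripleJoin m ρ ≠ ⊤ → ∃ (Q : Type) (_ : Group Q) (_ : Finite Q) (f : S m →* Q),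
      tripleJoin m ρ ≤ f.ker ∧ ∃ s, f s ≠ 1) :
    tripleJoin m ρ = ⊤ := by
  by_contra hne
  obtain ⟨Q, _, _, f, hf, s, hs⟩ := hq hne
  exact hs (hom_trivial_of_productCongruent h f hf s)

end Cofinal

/-! ## Dividend (sorry-free): P3 is a THEOREM at the first open type `m = 0` (cyclic collapse) -/

section GenusThree

instance tripleJoin_normal (m : ℕ) (ρ : S m ≃* S m) : (tripleJoin m ρ).Normal := by
  haveI : (N m 0 ⊔ N m 1).Normal := Subgroup.sup_normal _ _
  exact Subgroup.sup_normal _ _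

/-- At genus 3 every generator other than `b₀` lies in `N₀ ⊔ N₁ ≤ tripleJoin 0 ρ`. -/
theorem of_mem_tripleJoin_zero (ρ : S 0 ≃* S 0) (p : surfaceGen 3) (hp : p ≠ (0, true)) :
    (PresentedGroup.of p : S 0) ∈ tripleJoin 0 ρ := by
  have h0 : ∀ x ∈ ({SurfaceGroup.a 0, SurfaceGroup.a 1, SurfaceGroup.b 2} : Set (SurfaceGroup 3)),
      (x : S 0) ∈ tripleJoin 0 ρ := fun x hx =>
    mem_sup_left (mem_sup_left (show x ∈ s4Kernels 0 from subset_normalClosure hx))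
  have h1 : ∀ x ∈ ({SurfaceGroup.a 0, SurfaceGroup.b 1, SurfaceGroup.a 2} : Set (SurfaceGroup 3)),
      (x : S 0) ∈ tripleJoin 0 ρ := fun x hx =>
    mem_sup_left (mem_sup_right (show x ∈ s4Kernels 1 from subset_normalClosure hx))
  obtain ⟨i, bit⟩ := p
  fin_cases i <;> cases bit
  · exact h0 _ (by simp [SurfaceGroup.a])
  · exact absurd rfl hp
  · exact h0 _ (by simp [SurfaceGroup.a])
  · exact h1 _ (by simp [SurfaceGroup.b])
  · exact h1 _ (by simp [SurfaceGroup.a])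
  · exact h0 _ (by simp [SurfaceGroup.b])

/-- Hence `G_ρ = S₃ ⧸ tripleJoin 0 ρ` is cyclic, generated by the image of `b₀`. -/
theorem zpowers_b0_eq_top (ρ : S 0 ≃* S 0) :
    Subgroup.zpowers ((QuotientGroup.mk (SurfaceGroup.b 0 : S 0)) : S 0 ⧸ tripleJoin 0 ρ) = ⊤ := by
  rw [eq_top_iff, ← Subgroup.map_top_of_surjective _ (QuotientGroup.mk'_surjective (tripleJoin 0 ρ)),
    ← PresentedGroup.closure_range_of, MonoidHom.map_closure, Subgroup.closure_le]
  rintro _ ⟨_, ⟨p, rfl⟩, rfl⟩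
  by_cases hp : p = (0, true)
  · subst hp
    exact Subgroup.mem_zpowers _
  · rw [SetLike.mem_coe, QuotientGroup.mk'_apply,
      (QuotientGroup.eq_one_iff _).2 (of_mem_tripleJoin_zero ρ p hp)]
    exact one_mem _

/-- **P3 at `m = 0`** (cyclic collapse): for every product-congruent `ρ` of genus 3, `N₀ ⊔ N₁ ⊔ ρN₂ = S₃`. -/
theorem tripleJoin_zero_eq_top (ρ : S 0 ≃* S 0) (h : ProductCongruent 0 ρ) : tripleJoin 0 ρ = ⊤ := by
  refine tripleJoin_eq_top_of_finiteQuotient h fun hne => ?_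
  have hcyc : IsCyclic (S 0 ⧸ tripleJoin 0 ρ) :=
    isCyclic_iff_exists_zpowers_eq_top.2 ⟨_, zpowers_b0_eq_top ρ⟩
  haveI hnt : Nontrivial (S 0 ⧸ tripleJoin 0 ρ) := by
    by_contra hc
    rw [not_nontrivial_iff_subsingleton] at hc
    exact hne (QuotientGroup.subgroup_eq_top_of_subsingleton _ hc)
  have hcard : Nat.card (S 0 ⧸ tripleJoin 0 ρ) ≠ 1 := fun hc =>
    not_subsingleton _ (Nat.card_eq_one_iff_unique.1 hc).1
  obtain ⟨p, hp, hpd⟩ := Nat.exists_prime_and_dvd hcard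
  haveI : Fact p.Prime := ⟨hp⟩
  let e : Multiplicative (ZMod (Nat.card (S 0 ⧸ tripleJoin 0 ρ))) ≃* S 0 ⧸ tripleJoin 0 ρ :=
    zmodCyclicMulEquiv hcyc
  let r : Multiplicative (ZMod (Nat.card (S 0 ⧸ tripleJoin 0 ρ))) →* Multiplicative (ZMod p) :=
    AddMonoidHom.toMultiplicative (ZMod.castHom hpd (ZMod p)).toAddMonoidHom
  let f : S 0 →* Multiplicative (ZMod p) :=
    r.comp (e.symm.toMonoidHom.comp (QuotientGroup.mk' (tripleJoin 0 ρ)))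
  have hr : Function.Surjective r := fun y => by
    obtain ⟨x, hx⟩ := ZMod.ringHom_surjective (ZMod.castHom hpd (ZMod p)) y.toAdd
    exact ⟨Multiplicative.ofAdd x, by simp [r, hx]⟩
  have hf : Function.Surjective f :=
    hr.comp (e.symm.surjective.comp (QuotientGroup.mk'_surjective _))
  refine ⟨Multiplicative (ZMod p), inferInstance, inferInstance, f, ?_, ?_⟩
  · intro s hs
    rw [MonoidHom.mem_ker]
    simp [f, (QuotientGroup.eq_one_iff s).2 hs]
  · obtain ⟨s, hs⟩ := hf (Multiplicative.ofAdd 1)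
    refine ⟨s, ?_⟩
    rw [hs]
    intro h1
    simp at h1

/-- The registered stub (genera `≥ 6`) and the genus-3 theorem give P3 at all genera. -/
theorem limitsSimplyConnected_of_pos (h : LimitsSimplyConnectedPos) : LimitsSimplyConnected := by
  intro m
  cases m with
  | zero => exact tripleJoin_zero_eq_top
  | succ m => exact h m

end GenusThree

/-! ## Composition -/

/-- The two twisted pair quotients of a product-congruent `ρ` are free of rank `m+1`
(P1 + P2 on the shadows handed over by the hypothesis). -/
theorem free_pairQuot_of_productCongruent (h₁ : PairShadowFiniteQuotients) (h₂ : ProfiniteFreenessDetection)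
    {m : ℕ} {ρ : S m ≃* S m} (hρ : ProductCongruent m ρ) (i : Fin 3) (hi : i ≠ 2) :
    IsFreeOfRank (pairQuot m i ρ) (m + 1) :=
  h₂ m i hi ρ (h₁ m i hi ρ (pairShadow_of_productCongruent hρ i hi))

/-- **GATE FROM THE FOUR PARTS** (sorry-free): P1 + P2 free the two twisted pair quotients, P3 kills `G_ρ`,
so `T_ρ` is a group trisection of `{1}` on the fine locus, P4 makes it standard, and `Iso N T_ρ` is the crux
conclusion. -/
theorem gate_of_parts (h₁ : PairShadowFiniteQuotients) (h₂ : ProfiniteFreenessDetection)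
    (h₃ : LimitsSimplyConnected) (h₄ : FineApprox) (m : ℕ) (ρ : S m ≃* S m)
    (hρ : ProductCongruent m ρ) : IsProduct m ρ :=
  isProduct_of_iso (h₄ m ρ hρ (isGroupTrisection_twisted
    (free_pairQuot_of_productCongruent h₁ h₂ hρ 0 (by decide))
    (free_pairQuot_of_productCongruent h₁ h₂ hρ 1 (by decide)) (h₃ m ρ hρ)))

/-- **The skeleton concludes the crux BY NAME** (the only theorem in this file whose conclusion is
the route decl; no hypotheses; `sorry` enters only through the four registered stubs). -/
theorem HeegaardHandlebodyCongruenceClosed_of : HeegaardHandlebodyCongruenceClosed :=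
  crux_iff.2 (gate_of_parts p1_of_stub p2_of_stub (limitsSimplyConnected_of_pos p3_of_stub) p4_of_stub)

/-! ## Certificates (sorry-free): the two OPEN stubs are NECESSARY; P4 follows from two existing items -/

/-- `IsProduct ρ ⇒ G_ρ = 1` (Disproof.lean `tripleJoin_eq_top_of_inGate`, re-proved). -/
theorem tripleJoin_eq_top_of_isProduct {m : ℕ} {ρ : S m ≃* S m} (h : IsProduct m ρ) :
    tripleJoin m ρ = ⊤ := by
  obtain ⟨α, hα⟩ := iso_of_isProduct h
  have h0 : (N m 0).map α.toMonoidHom = N m 0 := by simpa using hα 0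
  have h1 : (N m 1).map α.toMonoidHom = N m 1 := by simpa using hα 1
  have h2 : (N m 2).map α.toMonoidHom = (N m 2).map ρ.toMonoidHom := by simpa using hα 2
  show N m 0 ⊔ N m 1 ⊔ (N m 2).map ρ.toMonoidHom = ⊤
  rw [← h0, ← h1, ← h2, ← Subgroup.map_sup, ← Subgroup.map_sup, sup_N_eq_top]
  exact Subgroup.map_top_of_surjective _ α.surjective

/-- NECESSITY OF P3: the crux implies `LimitsSimplyConnected`. -/
theorem limitsSimplyConnected_of_crux (hC : HeegaardHandlebodyCongruenceClosed) :
    LimitsSimplyConnected :=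
  fun m ρ hρ => tripleJoin_eq_top_of_isProduct (crux_iff.1 hC m ρ hρ)

/-- NECESSITY OF P3 as registered (genus `≥ 6`). -/
theorem limitsSimplyConnectedPos_of_crux (hC : HeegaardHandlebodyCongruenceClosed) :
    LimitsSimplyConnectedPos :=
  fun m ρ hρ => limitsSimplyConnected_of_crux hC (m + 1) ρ hρ

/-- NECESSITY OF P4: the crux implies `FineApprox` (its conclusion IS `Iso N T_ρ`). -/
theorem fineApprox_of_crux (hC : HeegaardHandlebodyCongruenceClosed) : FineApprox :=
  fun m ρ hρ _ => iso_of_isProduct (crux_iff.1 hC m ρ hρ)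

/-- **P4 FOLLOWS FROM TWO EXISTING ITEMS**: `ShadowApproximation` (stmt-14595) and `WaldhausenPairs`
(stmt-14592) give `FineApprox` — on the fine locus `T_ρ` is a group trisection of `{1}` by hypothesis,
14592 normalises all its pairs, and the fine datum supplies standard shadows (`ψ := x_M`). -/
theorem fineApprox_of_shadowApproximation_of_waldhausenPairs (hSA : ShadowApproximation)
    (hW : WaldhausenPairs) : FineApprox := fun m ρ hρ hK =>
  hSA m (twisted m ρ) hK (hW m (twisted m ρ) hK) (tripleShadow_of_productCongruent hρ)

/-- The reduction is an EQUIVALENCE modulo P1 + P2: crux ⟺ (P3 ∧ P4). -/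
theorem crux_iff_parts (h₁ : PairShadowFiniteQuotients) (h₂ : ProfiniteFreenessDetection) :
    HeegaardHandlebodyCongruenceClosed ↔ LimitsSimplyConnectedPos ∧ FineApprox :=
  ⟨fun hC => ⟨limitsSimplyConnectedPos_of_crux hC, fineApprox_of_crux hC⟩,
    fun h => crux_iff.2 (gate_of_parts h₁ h₂ (limitsSimplyConnected_of_pos h.1) h.2)⟩

/-- **The crux (read through `crux_iff`) from P1, P2, P3 and the two existing items 14595, 14592.**
(Stated with the unfolded conclusion on purpose: the skeleton audit takes THE theorem concluding the crux by
name, `HeegaardHandlebodyCongruenceClosed_of`.) -/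
theorem gate_of_items (h₁ : PairShadowFiniteQuotients) (h₂ : ProfiniteFreenessDetection)
    (h₃ : LimitsSimplyConnectedPos) (hSA : ShadowApproximation) (hW : WaldhausenPairs) :
    ∀ (m : ℕ) (ρ : S m ≃* S m), ProductCongruent m ρ → IsProduct m ρ :=
  gate_of_parts h₁ h₂ (limitsSimplyConnected_of_pos h₃) (fineApprox_of_shadowApproximation_of_waldhausenPairs hSA hW)

/-- At `m = 0` the composition needs only P1, P2 and the genus-3 instance of P4: the private conjunct is
discharged by `tripleJoin_zero_eq_top`. -/
theorem gate_zero_of_parts (h₁ : PairShadowFiniteQuotients) (h₂ : ProfiniteFreenessDetection)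
    (h₄ : ∀ ρ : S 0 ≃* S 0, ProductCongruent 0 ρ →
      IsGroupTrisection (3 + 3 * 0) (0 + 1) (PUnit : Type) (twisted 0 ρ) →
      TrisectionKernels.Iso (N 0) (twisted 0 ρ))
    (ρ : S 0 ≃* S 0) (hρ : ProductCongruent 0 ρ) : IsProduct 0 ρ :=
  isProduct_of_iso (h₄ ρ hρ (isGroupTrisection_twisted
    (free_pairQuot_of_productCongruent h₁ h₂ hρ 0 (by decide))
    (free_pairQuot_of_productCongruent h₁ h₂ hρ 1 (by decide)) (tripleJoin_zero_eq_top ρ hρ)))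

end Summit.SmoothPoincare4.SmoothPoincare4.Cruxes.HeegaardHandlebodyCongruenceClosed.PairRigidityRetraction

end
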